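import Mathlib
import HarnessLib
import Literature.MathematicalPhysics.QuantumFieldTheory.ConstructiveQFTWave0Proofs
import Literature.MathematicalPhysics.QuantumFieldTheory.LatticeGaugeStaticPotentialProofs

/-!
# LatticeQCDFlow / Scaling — the non-abelian transport identity of a cube with flat lateral faces;
# no lone excited plaquette in dimension `d ≥ 3`, for EVERY gauge group

HONEST FRAMING: exact (Metropolis-corrected) sampling algorithms for lattice gauge theory;
figures of merit are autocorrelation/cost numbers at stated couplings and volumes; no
continuum-physics claim.

Venture `LatticeQCDFlow` (cell pub-lqcd), topic `Scaling`, FANOUT row 30 (lean-1, GEN-28) — OUR WORK on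
THEORY-2.md §4 row C5 (gen25 Q2), the NON-ABELIAN side, part 2.  `Scaling/NonAbelianSeamHolonomy` shows that
on `(ℤ/L)^2` a non-commutative gauge group admits a LONE EXCITED PLAQUETTE (holonomy `[a,b] ≠ 1` around one
plaquette, `1` around all others), which the abelian identity `∏_p U_p = 1` forbids.  In dimension `d ≥ 3`
no group admits one — the obstruction is the non-abelian Bianchi (cube) identity, proved here in the form
that needs no ordering conventions:

* §1 orientation: `U_{(x; j,i)} = U_{(x; i,j)}⁻¹` (`plaquetteHolonomy_swap`, Literature), so flatness
  (`U_{(x;i,j)} = 1`) does not depend on the orientation (**`plaquetteHolonomy_eq_one_comm`**);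
* §2 **`plaquetteHolonomy_eq_conj_of_lateral_flat`** — THE TRANSPORT IDENTITY: `i, j, a` pairwise distinct
  directions, `U` ANY configuration with the four LATERAL faces of the cube `x + [0,1]e_i + [0,1]e_j + [0,1]e_a`
  flat (`U_{(x;i,a)} = U_{(x;j,a)} = U_{(x+e_i; j,a)} = U_{(x+e_j; i,a)} = 1`); then the bottom face is the top
  face transported down the `a`-link: `U_{(x;i,j)} = U(x,a) · U_{(x+e_a; i,j)} · U(x,a)⁻¹` (each of the four
  link variables of the bottom face is rewritten through its flat lateral face; the inner `a`-links cancel);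
  hence (**`plaquetteHolonomy_eq_one_of_cube_flat`**) five flat faces of a cube force the sixth to be flat;
* §3 **`no_lone_plaquette_three_le`** — `d ≥ 3`, `L ≥ 2`, `G` ANY group: if every plaquette other than `p₀`
  is flat, so is `p₀` (the cube over `p₀` in a third direction `a`; its top face is another plaquette since
  `x + e_a ≠ x`); equivalently (**`two_le_card_excited`**) a configuration that is not flat has at least two
  excited plaquettes.  With `NonAbelianSeamHolonomy` (`d = 2`: lone excited plaquette iff `G` is
  non-commutative) this classifies lone excitations completely: they exist iff `d = 2` and `G` is
  non-commutative (`Scaling/TwoDimHolonomyDichotomy`).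

No `def`, no `sorry`, nothing cited as a fact beyond the tree.
-/

namespace Summit.Ventures.LatticeQCDFlow.Theory2.Autoregressive

open Finset
open Literature.MathematicalPhysics.QuantumFieldTheory

variable {d L : ℕ} {G : Type*} [Group G]

/-! ## §1 Orientation -/

/-- Flatness does not depend on the orientation (`plaquetteHolonomy_swap` of
`LatticeGaugeStaticPotentialProofs`: `U_{(x; j,i)} = U_{(x; i,j)}⁻¹`). [ours] -/
theorem plaquetteHolonomy_eq_one_comm (U : GaugeConfig d L G) (x : Site d L) (i j : Fin d) :
    plaquetteHolonomy U x j i = 1 ↔ plaquetteHolonomy U x i j = 1 := by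
  rw [plaquetteHolonomy_swap, inv_eq_one]

/-! ## §2 The transport identity -/

/-- A flat face `(y; m, a)` rewrites its `m`-link through the `a`-direction:
`U(y, m) = U(y, a) · U(y + e_a, m) · U(y + e_m, a)⁻¹`. [ours] -/
theorem apply_eq_of_flat (U : GaugeConfig d L G) (y : Site d L) (m a : Fin d)
    (h : plaquetteHolonomy U y m a = 1) :
    U (y, m) = U (y, a) * U (y.shift a, m) * (U (y.shift m, a))⁻¹ := by
  rw [plaquetteHolonomy] at h
  -- `h : U(y,m) U(y+e_m,a) U(y+e_a,m)⁻¹ U(y,a)⁻¹ = 1`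
  have h1 : U (y, m) * U (y.shift m, a) = U (y, a) * U (y.shift a, m) := by
    have := h
    rw [mul_inv_eq_one, mul_inv_eq_iff_eq_mul] at this
    exact this
  rw [← h1, mul_inv_cancel_right]

/-- **THE TRANSPORT IDENTITY.**  `i, j, a` pairwise distinct; the four lateral faces of the cube at `x` spanned
by `e_i, e_j, e_a` are flat.  Then `U_{(x;i,j)} = U(x,a) · U_{(x+e_a; i,j)} · U(x,a)⁻¹`. [ours] -/
theorem plaquetteHolonomy_eq_conj_of_lateral_flat (U : GaugeConfig d L G) (x : Site d L) {i j a : Fin d}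
    (h1 : plaquetteHolonomy U x i a = 1) (h2 : plaquetteHolonomy U x j a = 1)
    (h3 : plaquetteHolonomy U (x.shift i) j a = 1) (h4 : plaquetteHolonomy U (x.shift j) i a = 1) :
    plaquetteHolonomy U x i j = U (x, a) * plaquetteHolonomy U (x.shift a) i j * (U (x, a))⁻¹ := by
  rw [plaquetteHolonomy, plaquetteHolonomy, apply_eq_of_flat U x i a h1, apply_eq_of_flat U (x.shift i) j a h3,
    apply_eq_of_flat U (x.shift j) i a h4, apply_eq_of_flat U x j a h2, WilsonRP.shift_comm x i a,
    WilsonRP.shift_comm x j a, WilsonRP.shift_comm x i j]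
  simp only [mul_inv_rev, inv_inv, mul_assoc, inv_mul_cancel_left]

/-- **Five flat faces of a cube force the sixth to be flat** (any group). [ours] -/
theorem plaquetteHolonomy_eq_one_of_cube_flat (U : GaugeConfig d L G) (x : Site d L) {i j a : Fin d}
    (h1 : plaquetteHolonomy U x i a = 1) (h2 : plaquetteHolonomy U x j a = 1)
    (h3 : plaquetteHolonomy U (x.shift i) j a = 1) (h4 : plaquetteHolonomy U (x.shift j) i a = 1)
    (h5 : plaquetteHolonomy U (x.shift a) i j = 1) : plaquetteHolonomy U x i j = 1 := by
  rw [plaquetteHolonomy_eq_conj_of_lateral_flat U x h1 h2 h3 h4, h5, mul_one, mul_inv_cancel]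

/-! ## §3 No lone excited plaquette in dimension `≥ 3` -/

/-- If every plaquette other than `p₀` is flat, then `U_{(y; m, n)} = 1` for every `m ≠ n` as soon as `(y; m, n)`
is not `p₀` up to orientation: `y ≠ p₀.1`, or `m` or `n` lies outside the plane of `p₀`. [ours] -/
theorem eq_one_of_others_flat (U : GaugeConfig d L G) (p₀ : Plaquette d L)
    (h : ∀ p : Plaquette d L, p ≠ p₀ → plaquetteHolonomy U p.1 p.2.1.1 p.2.1.2 = 1)
    (y : Site d L) {m n : Fin d} (hmn : m ≠ n)
    (hy : y ≠ p₀.1 ∨ (m ≠ p₀.2.1.1 ∧ m ≠ p₀.2.1.2) ∨ (n ≠ p₀.2.1.1 ∧ n ≠ p₀.2.1.2)) :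
    plaquetteHolonomy U y m n = 1 := by
  rcases lt_or_gt_of_ne hmn with hlt | hgt
  · refine h (y, ⟨(m, n), hlt⟩) fun hq => ?_
    have h1 : y = p₀.1 := congrArg Prod.fst hq
    have h2 : m = p₀.2.1.1 := by rw [← hq]
    have h3 : n = p₀.2.1.2 := by rw [← hq]
    rcases hy with hy | ⟨hm, -⟩ | ⟨-, hn⟩
    · exact hy h1
    · exact hm h2
    · exact hn h3
  · rw [← plaquetteHolonomy_eq_one_comm]
    refine h (y, ⟨(n, m), hgt⟩) fun hq => ?_
    have h1 : y = p₀.1 := congrArg Prod.fst hq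
    have h2 : n = p₀.2.1.1 := by rw [← hq]
    have h3 : m = p₀.2.1.2 := by rw [← hq]
    rcases hy with hy | ⟨-, hm⟩ | ⟨hn, -⟩
    · exact hy h1
    · exact hm h3
    · exact hn h2

/-- In dimension `d ≥ 3` every plane has a third direction. [ours] -/
theorem exists_third_dir (hd : 3 ≤ d) (i j : Fin d) : ∃ a : Fin d, a ≠ i ∧ a ≠ j := by
  classical
  by_contra hno
  push Not at hno
  have hsub : (Finset.univ : Finset (Fin d)) ⊆ {i, j} := fun a _ => by
    by_cases hai : a = i
    · simp [hai]
    · simp [hno a hai]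
  have h1 := Finset.card_le_card hsub
  have h2 : ({i, j} : Finset (Fin d)).card ≤ 2 := Finset.card_le_two
  rw [Finset.card_univ, Fintype.card_fin] at h1
  omega

/-- **NO LONE EXCITED PLAQUETTE IN DIMENSION `d ≥ 3`, FOR EVERY GAUGE GROUP.**  `L ≥ 2`; `U` any configuration;
if every plaquette other than `p₀` is flat, so is `p₀`: the cube over `p₀ = (x; i<j)` in a third direction `a`
has its four lateral faces and its top face `(x + e_a; i<j) ≠ p₀` flat, and the transport identity gives
`U_{p₀} = U(x,a)·1·U(x,a)⁻¹ = 1`.  (On `(ℤ/L)^2` this fails for every non-commutative `G`: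
`NonAbelianSeamHolonomy.exists_lone_plaquette_two_dim`.) [ours] -/
theorem no_lone_plaquette_three_le (hd : 3 ≤ d) (hL : 2 ≤ L) (U : GaugeConfig d L G) (p₀ : Plaquette d L)
    (h : ∀ p : Plaquette d L, p ≠ p₀ → plaquetteHolonomy U p.1 p.2.1.1 p.2.1.2 = 1) :
    plaquetteHolonomy U p₀.1 p₀.2.1.1 p₀.2.1.2 = 1 := by
  obtain ⟨x, ⟨⟨i, j⟩, hij⟩⟩ := p₀
  obtain ⟨a, hai, haj⟩ := exists_third_dir hd i j
  have hij' : i ≠ j := ne_of_lt hij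
  -- the top face is another plaquette: `x + e_a ≠ x` since `L ≥ 2`
  have htop : x.shift a ≠ x := by
    intro hx
    have h1 := congrFun hx a
    simp only [Site.shift, Pi.add_apply, Pi.single_eq_same, add_eq_left] at h1
    have h2 := congrArg ZMod.val h1
    rw [ZMod.val_one'' (by omega), ZMod.val_zero] at h2
    exact one_ne_zero h2
  dsimp only
  exact plaquetteHolonomy_eq_one_of_cube_flat U x
    (eq_one_of_others_flat U _ h x hai.symm (Or.inr (Or.inr ⟨hai, haj⟩)))
    (eq_one_of_others_flat U _ h x haj.symm (Or.inr (Or.inr ⟨hai, haj⟩)))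
    (eq_one_of_others_flat U _ h (x.shift i) haj.symm (Or.inr (Or.inr ⟨hai, haj⟩)))
    (eq_one_of_others_flat U _ h (x.shift j) hai.symm (Or.inr (Or.inr ⟨hai, haj⟩)))
    (eq_one_of_others_flat U _ h (x.shift a) hij' (Or.inl htop))

/-- **Equivalently: in dimension `d ≥ 3` a configuration that is not flat has at least two excited
plaquettes** (any group). [ours] -/
theorem exists_two_excited_three_le (hd : 3 ≤ d) (hL : 2 ≤ L) (U : GaugeConfig d L G) (p₀ : Plaquette d L)
    (h₀ : plaquetteHolonomy U p₀.1 p₀.2.1.1 p₀.2.1.2 ≠ 1) :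
    ∃ p : Plaquette d L, p ≠ p₀ ∧ plaquetteHolonomy U p.1 p.2.1.1 p.2.1.2 ≠ 1 := by
  by_contra hno
  push Not at hno
  exact h₀ (no_lone_plaquette_three_le hd hL U p₀ hno)

end Summit.Ventures.LatticeQCDFlow.Theory2.Autoregressive
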